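/-
Copyright (c) 2026 the pub-hodgecm-mathlib formalisation cell (harness21).  Prover seat hodgecm-mathlib-K2E1-p14 (g5), Track B ∕ K2-LIT, h413 = `stmt-HodgeConjecture-24833`,
R90-TF section S8 «ContSpec-n½», socket B MID :358, deal (V-τ) ED. 2 (S8-R299 (a), dealer R90-CS-plan (g4)): the Maass–Selberg letter `hMS` of ★ p865372 (V-τ) ED. 1 DISCHARGED by
★ p865152's exports-level packager `hMS32_of_exports_free`, fed — exactly as (R)′τ OF RECORD V3 (★ p865313) feeds its scattering package — by ★ FILE A's factorised columns of the
witness, the Euler junction at `3∕2`, ★ F5's scalar residue, ★ `exists_scalars_of_coords_global` and the per-coordinate simple-pole devices of ★ `K2E1ChiMS32OfUnfoldingCMThree`;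
the letters that replace `hMS` are V3's canonical ones: `hunfK`, `hPreal` (per section) and `hreal` (per generator).
-/
import Summits.HodgeConjecture.HodgeConjecture.Theorems.R90S8ResGMidBlockNeBotOfTauGeneratorLettersU3   -- ★ p865372 (this seat): (V-τ) ED. 1 `resGMidBlock_ne_bot_of_tauGenerator_letters`
import Summits.HodgeConjecture.HodgeConjecture.Theorems.R90S8ResGMidBlockLeResidualOfRecordV3U3       -- ★ p865313 (K2E2-p12 (g10)): (R)′τ V3 — brings ★ `columnsFactorisedRow_of_ports`, ★ `eventuallyEq_coord_of_junction`, ★ `integrable_restrict_mul_conj_of_bounded`, ★ F5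
import Summits.HodgeConjecture.HodgeConjecture.Theorems.R90S8ResGMidMS32OfRecordU3                    -- ★ p865152 (LH4-p10 (g9)): `hMS32_of_exports_free`; brings ★ `exists_scalars_of_coords_global`, ★ `midBlockChar_posRealIdele`
import Summits.HodgeConjecture.HodgeConjecture.Theorems.K2E1ChiMS32OfUnfoldingCMThree                  -- ★ (K2E1-p13∕p15): `exists_simplePole_of_coords_formula`, `exists_sqPole_kernelDiag_of_coords`
import Summits.HodgeConjecture.HodgeConjecture.Theorems.R90S8ResGMidTauAxisLettersOfPortsU3             -- ★ (K2E3-p29): `isClosed_of_codiscrete` (and the ★ payer `hreal_row_of_ports` of the axis letter)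
import HarnessLib

/-!
# S8 socket B MID — `R90S8ResGMidBlockNeBotOfTauGeneratorLettersV2U3` ((V-τ), ED. 2): ED. 1 with the Maass–Selberg letter `hMS` DISCHARGED — visible instead (R)′τ V3's canonical
# letters `hunfK`, `hPreal`, `hreal` and the Maass–Selberg frame extras `μK νI 𝓕I`

Track B ∕ K2-LIT, crux h413 = `stmt-HodgeConjecture-24833`, route of record `HCCMUnconditional`; cell `hodgecm-mathlib`, R90-TF programme, section S8 «ContSpec-n½», socket B MID :358
∕ (V), general sub-row (V-τ).  THEOREMS ONLY (no `def`, no `instance`, no `notation`, no named-fact hypothesis, no `sorry`; default heartbeats); lane `--supports stmt-HodgeConjecture-24833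
--as helper` (count-neutral).  CLOSES NO SOCKET (letters ≠ payment).

THE DISCHARGE (§1 **`hMS_tauWitness_of_columnLetters`** ⊢ ED. 1's `hMS` letter BYTE FOR BYTE).  For every export candidate `(Ec, P, Fam)` of the witness `φ` (tube identity, `P` co-discrete
— hence closed, ★ `isClosed_of_codiscrete` —, `Fam` holomorphic off `P` with `Fam z =ᵐ quotFun (Λ¹(Ec z))` off `P`): ★ FILE A `columnsFactorisedRow_of_ports … hμu hunfK hPreal` gives the
factorised scattering columns `(φ′, qv, qcv, Pv, a)` of `φ` at the package; ★ F5 `exists_residue_at_threeHalves_cm_three` + ★ `exists_analyticAt_eventuallyEq_mul_sub_of_tendsto` give the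
scalar pole letter `d₀ = (z − 3∕2)·qc` analytic at `3∕2`; the junction ★ `eventuallyEq_coord_of_junction` gives `qcv_j = qc·(a_j∕A)` near `3∕2`, so `dq_j := d₀·(a_j∕A)` is analytic at `3∕2`
with `dq_j = (z − 3∕2)·qcv_j` on the punctured neighbourhood; ★ `exists_scalars_of_coords_global` (on `P ∪ Pv`) gives the continued scalars `wc, Bc` with their tube agreements and closed
formulas, whence the pole data `d` (★ `exists_simplePole_of_coords_formula`) and the kernel bound (★ `exists_sqPole_kernelDiag_of_coords`); the axis letter `hreal` gives
`Im wc = 0` on the punctured real trace; ★ `hMS32_of_exports_free` (block character unitary ★ `isUnitary_blockChar`, trivial on `ℝ_{>0}` ★ `midBlockChar_posRealIdele`, `‖ξ.ψ‖ = 1` ★,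
`ξ.hψ`) concludes `∃ C, ∀ᶠ z in 𝓝[≠] (3∕2), ‖(z − 3∕2) • Fam z‖ ≤ C`.
§2 HEAD **`resGMidBlock_ne_bot_of_tauGenerator_letters_v2`** = ★ ED. 1 `resGMidBlock_ne_bot_of_tauGenerator_letters` with `hMS := §1`: binders = ED. 1's minus `hMS`, plus the
Maass–Selberg frame extras `(μK) [Haar] (νI) [Haar] {𝓕I} (h𝓕I)` and V3's letters `hunfK hPreal hreal` (bytes of ★ p865313 :117–:161).
VISIBLE → PAYER after ED. 2: `hPL` ⇐ (MSP′) off-axis + τ-MS32 pointwise; `hCT` ⇐ ★ CT ∘ ★ p864880 ∘ `hunfK^τ` (ED. 2′); `hsrc hA32` ⇐ ★ p864821 + ★ `hA32_shifted…`; `hunfK` ⇐ ★ p865072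
∘ ★ p864998 ∘ ★ p865311 (pure tensors); `hPreal` ⇐ ★ `hPreal_row_of_offAxisBound` modulo `hOFFBD`; `hreal` ⇐ ★ `hreal_row_of_ports` (independent columns).
HONEST LABEL: HC_CM is proved only modulo the 7 printed citations (2 remaining named inputs: hLiu418 = `stmt-HodgeConjecture-24832`, h413 = `stmt-HodgeConjecture-24833`) until
rung 0 closes; (V-τ) ED. 2 = ★ ED. 1 with `hMS` ★-discharged MODULO {`hunfK`, `hPreal`, `hreal`} (the (R)′τ board letters) — letters, not payments; :358 stays `sorry` in B; REL ≠ ★ ≠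
WRITTEN ≠ BUILT; count-neutral.

## References
* [MoeglinWaldspurger1995] C. Mœglin, J.-L. Waldspurger, *Spectral Decomposition and Eisenstein Series* (1995), IV.1.10–IV.1.11, IV.2.3, IV.3.12 (a), V.3.13.
* [Langlands1976] R. P. Langlands, *On the Functional Equations Satisfied by Eisenstein Series*, LNM 544 (1976), §6–§7.
* [BernsteinLapid2019] J. Bernstein, E. Lapid, *On the meromorphic continuation of Eisenstein series*, J. Amer. Math. Soc. 37 (2024), Thm 2.3, §4.
* [Rogawski1990] J. D. Rogawski, *Automorphic Representations of Unitary Groups in Three Variables* (1990), §13.9 (ii) p. 229.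
-/

set_option autoImplicit false
set_option linter.dupNamespace false  -- the mandated namespace `…HodgeConjecture.HodgeConjecture.R90.S8` (LEAD #1 L1) repeats the summit's segment

noncomputable section

open MeasureTheory Measure NumberField IsDedekindDomain Set Filter Topology Metric Function ContRepresentation
open scoped ENNReal NNReal MatrixGroups ComplexConjugate
open Literature.MeasureTheory.Group Literature.NumberTheory Literature.RepresentationTheory.CompactGroups
open Literature.NumberTheory.Automorphic Literature.NumberTheory.Automorphic.UnitaryGroup Literature.NumberTheory.LFunctions Literature.NumberTheory.GaloisRepresentations AdelicGroupData
open Literature.NumberTheory.Automorphic.Arthur2013.Leaves.TECR Literature.NumberTheory.Rogawski1990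
open Summit.HodgeConjecture.HodgeConjecture.Cruxes.H413.K2E1BorelEisensteinU
open Summit.HodgeConjecture.HodgeConjecture.Cruxes.H413.K2E1BLBorelSpacesU2Defs
open Summit.HodgeConjecture.HodgeConjecture.Cruxes.H413.K2E1BLBorelOperatorsU2Defs
open Summit.HodgeConjecture.HodgeConjecture.Cruxes.H413.K2E1CharacterEisensteinU2Defs
open Summit.HodgeConjecture.HodgeConjecture.Cruxes.H413.K2E1ChiSectionSpaceU2Defs
open Summit.HodgeConjecture.HodgeConjecture.Cruxes.H413.K2E1CharacterEisensteinU3PairDefs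
open Summit.HodgeConjecture.HodgeConjecture.Cruxes.H413.K2E1ChiSectionSpaceU3PairDefs
open Summit.HodgeConjecture.HodgeConjecture.Cruxes.H413.K2E1HeckeLHalfNeZeroDefs (LHalfNeZero)
open Summit.HodgeConjecture.HodgeConjecture.Cruxes.H413.K2E1ChiScatteringMiddlePoleU3 (exists_residue_at_threeHalves_cm_three)
open Summit.HodgeConjecture.HodgeConjecture.Cruxes.H413.K2E1SphericalEisensteinResidueConstantCMThreeOfLetters (exists_analyticAt_eventuallyEq_mul_sub_of_tendsto)
open Summit.HodgeConjecture.HodgeConjecture.Cruxes.H413.R90S8ResGMidBlockScatteringOfRecordU3 (integrable_restrict_mul_conj_of_bounded)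
open Summit.HodgeConjecture.HodgeConjecture.Cruxes.H413.K2E1ChiMaassSelbergOnAxisScalarsOfRecordCMThree (exists_scalars_of_coords_global)
open Summit.HodgeConjecture.HodgeConjecture.Cruxes.H413.K2E1ChiMS32OfUnfoldingCMThree (exists_simplePole_of_coords_formula exists_sqPole_kernelDiag_of_coords)

namespace Summit.HodgeConjecture.HodgeConjecture.R90.S8

variable (L : Type) [Field L] [NumberField L] [IsCMField L]
  [MeasurableSpace (quasiSplit (↥(maximalRealSubfield L)) L (IsCMField.complexConj L) 3).Adelic] [BorelSpace (quasiSplit (↥(maximalRealSubfield L)) L (IsCMField.complexConj L) 3).Adelic]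
  [MeasurableSpace (arch (↥(maximalRealSubfield L)) L (IsCMField.complexConj L) 3 ((StdForm.antidiagonal 3).over L))] [BorelSpace (arch (↥(maximalRealSubfield L)) L (IsCMField.complexConj L) 3 ((StdForm.antidiagonal 3).over L))]
  [MeasurableSpace (finAdelic (↥(maximalRealSubfield L)) L (IsCMField.complexConj L) 3 ((StdForm.antidiagonal 3).over L))] [BorelSpace (finAdelic (↥(maximalRealSubfield L)) L (IsCMField.complexConj L) 3 ((StdForm.antidiagonal 3).over L))]
  [MeasurableSpace (AdeleRing (𝓞 L) L)ˣ] [BorelSpace (AdeleRing (𝓞 L) L)ˣ]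

/-! ## §1 ED. 1's Maass–Selberg letter `hMS` from (R)′τ V3's letters -/

/-- **§1 — `hMS_tauWitness_of_columnLetters`**: ★ ED. 1's letter `hMS` for the τ-admissible witness `(U₀, φ)` at the normalised Heisenberg package, BYTE FOR BYTE, from the (V) frame,
the exports' frame (F)(F′), the (iii) scalar block, the Maass–Selberg frame extras and (R)′τ V3's letters `hunfK hPreal hreal` — the chain of the module docstring (★ FILE A columns → ★
junction → ★ F5 residue → ★ `exists_scalars_of_coords_global` on `P ∪ Pv` → ★ simple-pole devices → `hreal` → ★ `hMS32_of_exports_free`).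
[cite: MoeglinWaldspurger1995, IV.1.10–IV.1.11, IV.2.3, IV.3.12 (a)] [cite: Langlands1976, §7] [cite: BernsteinLapid2019, §4] -/
theorem hMS_tauWitness_of_columnLetters
    (μ : Measure (quasiSplit (↥(maximalRealSubfield L)) L (IsCMField.complexConj L) 3).automorphicQuotient) [(quasiSplit (↥(maximalRealSubfield L)) L (IsCMField.complexConj L) 3).IsAutomorphicMeasure μ]
    (μω : HeckeCharacter L) (hμu : μω.IsUnitary)
    (hμω : ∀ x : ideleGroup ↥(maximalRealSubfield L), μω (AdeleRing.ideleBaseChange (↥(maximalRealSubfield L)) L x) = quadraticHeckeCharCM L x)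
    (ξ : OneDimAutRepH L)
    -- the exports' frame (F)(F′) of ★ p865131 (Haar measure on `G(𝔸)`, covering weight, quotient measure, the ports' auxiliary Haar measures)
    (νG : Measure (quasiSplit (↥(maximalRealSubfield L)) L (IsCMField.complexConj L) 3).Adelic) [νG.IsHaarMeasure] [νG.IsInvInvariant] [SFinite νG]
    {β : (quasiSplit (↥(maximalRealSubfield L)) L (IsCMField.complexConj L) 3).Adelic → ℝ≥0∞}
    (hβ : IsCoveringWeight ↥((arithmeticBorel (↥(maximalRealSubfield L)) L (IsCMField.complexConj L) 3).map (quasiSplit (↥(maximalRealSubfield L)) L (IsCMField.complexConj L) 3).arithmeticSubgroup.subtype) β)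
    {μZ : Measure (borelQuotient (↥(maximalRealSubfield L)) L (IsCMField.complexConj L) 3)} [SFinite μZ]
    (hμZ : ∀ f : borelQuotient (↥(maximalRealSubfield L)) L (IsCMField.complexConj L) 3 → ℝ≥0∞, Measurable f → ∫⁻ z, f z ∂μZ = ∫⁻ g, β g * f (toBorelQuotient (↥(maximalRealSubfield L)) L (IsCMField.complexConj L) 3 g) ∂νG)
    (μa : Measure (arch (↥(maximalRealSubfield L)) L (IsCMField.complexConj L) 3 ((StdForm.antidiagonal 3).over L))) [μa.IsHaarMeasure] [μa.IsMulRightInvariant]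
    (μf : Measure (finAdelic (↥(maximalRealSubfield L)) L (IsCMField.complexConj L) 3 ((StdForm.antidiagonal 3).over L))) [μf.IsHaarMeasure]
    -- (i) THE τ-ADMISSIBLE WITNESS AS DATA: a τ-level `U₀`, a continuous `K_∞`-finite pair-section of level `(ι_f U₀, 1)` (e.g. the shifted pure tensor `Φ^{p,q}_∞ ⊗ Φ_f`)
    (U₀ : Subgroup ↥(finAdelic (↥(maximalRealSubfield L)) L (IsCMField.complexConj L) 3 ((StdForm.antidiagonal 3).over L))) (hU₀ : IsTauLevel L U₀)
    (φ : (quasiSplit (↥(maximalRealSubfield L)) L (IsCMField.complexConj L) 3).Adelic → ℂ) (hφ : φ ∈ chiSectionSpacePair (ξ.bcη⁻¹ * ξ.bcψ⁻¹ * μω) ξ.ψ (tauLevel L U₀) ((1 : ↥(tauLevel L U₀) →* ℂ) : ↥(tauLevel L U₀) → ℂ)) (hφc : Continuous φ) (hφa : IsArchFinite L φ)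
    -- the NORMALISED Heisenberg package of ★ p865131's row (Haar, inversion-invariant, `ν 𝓕 = 1`)
    (ν : Measure ↥(adelicUnipotent (↥(maximalRealSubfield L)) L (IsCMField.complexConj L) 3)) [ν.IsHaarMeasure] [ν.IsInvInvariant]
    {𝓕 : Set ↥(adelicUnipotent (↥(maximalRealSubfield L)) L (IsCMField.complexConj L) 3)}
    (h𝓕N : IsFundamentalDomain ↥(rationalUnipotent (↥(maximalRealSubfield L)) L (IsCMField.complexConj L) 3) 𝓕 ν) (h𝓕c : IsCompact (closure 𝓕)) (h𝓕1 : ν 𝓕 = 1)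
    -- the (iii) scalar block's continued scalar `qc` (pole set `Pq`) and the F5 inputs (ED. 1's binders)
    (q qc : ℂ → ℂ) {Pq : Set ℂ} (hqcq : ∀ z : ℂ, 2 < z.re → qc z = q z) (hPqcd : ∀ z₀ : ℂ, ∀ᶠ s in 𝓝[≠] z₀, s ∉ Pq) (hqa : ∀ z : ℂ, z ∉ Pq → AnalyticAt ℂ qc z)
    -- (iii) ★ p863385's row (iii) VERBATIM (payers: ★ p864821 + ★ `hA32_shifted_of_record_at_basePoint_of_modEq` for the shifted pure tensor)
    {S : Set (HeightOneSpectrum (𝓞 L))} {T' : Set (HeightOneSpectrum (𝓞 ↥(maximalRealSubfield L)))}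
    (hS : S.Finite) (hurφ : ∀ w ∉ S, (ξ.bcη⁻¹ * μω).IsUnramifiedAt w) (hT' : T'.Finite) (hurη : ∀ v ∉ T', (1 : HeckeCharacter ↥(maximalRealSubfield L)).IsUnramifiedAt v)
    (A : ℂ → ℂ) (hA : DifferentiableOn ℂ A {z : ℂ | 1 < z.re})
    (hsrc : ∀ z : ℂ, 2 < z.re → q z = A z *
          ((partialStandardL S (fun w => {(ξ.bcη⁻¹ * μω).valueAtUniformizer w}) (z - 1) * partialStandardL T' (fun v => {(1 : HeckeCharacter ↥(maximalRealSubfield L)).valueAtUniformizer v}) (2 * z - 2)) /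
            (partialStandardL S (fun w => {(ξ.bcη⁻¹ * μω).valueAtUniformizer w}) z * partialStandardL T' (fun v => {(1 : HeckeCharacter ↥(maximalRealSubfield L)).valueAtUniformizer v}) (2 * z - 1))))
    (hA32 : A (3 / 2) ≠ 0)
    -- the Maass–Selberg frame extras of ★ p865152 (Haar measure on `K_max`, Haar measure on the ideles, an idele-class domain)
    (μK : Measure ↥((standardMaximalCompactGL 3 L).comap (adelicVal (↥(maximalRealSubfield L)) L (IsCMField.complexConj L) 3 ((StdForm.antidiagonal 3).over L)) : Subgroup (quasiSplit (↥(maximalRealSubfield L)) L (IsCMField.complexConj L) 3).Adelic)) [μK.IsHaarMeasure]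
    (νI : Measure (AdeleRing (𝓞 L) L)ˣ) [νI.IsHaarMeasure] {𝓕I : Set (AdeleRing (𝓞 L) L)ˣ} (h𝓕I : IsIdeleClassDomain L 𝓕I)
    -- PER τ-ADMISSIBLE SECTION — (R)′τ V3's letters VERBATIM (★ p865313 :117–:143): the Euler factorisation on `K_max` at the scalar of record (`hunfK^τ`, ★ p865072 for pure tensors) and the off-axis pole exclusion
    (hunfK :
      ∀ (U₀ : Subgroup ↥(finAdelic (↥(maximalRealSubfield L)) L (IsCMField.complexConj L) 3 ((StdForm.antidiagonal 3).over L))) (_ : IsTauLevel L U₀)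
      (φ : (quasiSplit (↥(maximalRealSubfield L)) L (IsCMField.complexConj L) 3).Adelic → ℂ) (_ : φ ∈ chiSectionSpacePair (ξ.bcη⁻¹ * ξ.bcψ⁻¹ * μω) ξ.ψ (tauLevel L U₀) ((1 : ↥(tauLevel L U₀) →* ℂ) : ↥(tauLevel L U₀) → ℂ)) (_ : Continuous φ)
      (_ : IsArchFinite L φ)
      (ν : Measure ↥(adelicUnipotent (↥(maximalRealSubfield L)) L (IsCMField.complexConj L) 3)) (_ : ν.IsHaarMeasure) (𝓕 : Set ↥(adelicUnipotent (↥(maximalRealSubfield L)) L (IsCMField.complexConj L) 3)) (_ : IsFundamentalDomain ↥(rationalUnipotent (↥(maximalRealSubfield L)) L (IsCMField.complexConj L) 3) 𝓕 ν) (_ : IsCompact (closure 𝓕)) (_ : ν.IsInvInvariant) (_ : ν 𝓕 = 1),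
      ∀ k : (quasiSplit (↥(maximalRealSubfield L)) L (IsCMField.complexConj L) 3).Adelic, adelicVal (↥(maximalRealSubfield L)) L (IsCMField.complexConj L) 3 ((StdForm.antidiagonal 3).over L) k ∈ standardMaximalCompactGL 3 L →
        ∃ A' : ℂ → ℂ, DifferentiableOn ℂ A' {z : ℂ | 1 < z.re} ∧ ∀ z : ℂ, 2 < z.re →
          (∫ v : ↥(adelicUnipotent (↥(maximalRealSubfield L)) L (IsCMField.complexConj L) 3), flatSectionU φ z ((quasiSplit (↥(maximalRealSubfield L)) L (IsCMField.complexConj L) 3).toAdelic (weylLongU ((IsCMField.complexConj L : L ≃ₐ[↥(maximalRealSubfield L)] L) : L →+* L) (rfl : (StdForm.antidiagonal 3).over L = (StdForm.antidiagonal 3).over L)) * ((v : (quasiSplit (↥(maximalRealSubfield L)) L (IsCMField.complexConj L) 3).Adelic) * k)) ∂ν) =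
            ((partialStandardL S (fun w => {(ξ.bcη⁻¹ * μω).valueAtUniformizer w}) (z - 1) * partialStandardL T' (fun v => {(1 : HeckeCharacter ↥(maximalRealSubfield L)).valueAtUniformizer v}) (2 * z - 2)) / (partialStandardL S (fun w => {(ξ.bcη⁻¹ * μω).valueAtUniformizer w}) z * partialStandardL T' (fun v => {(1 : HeckeCharacter ↥(maximalRealSubfield L)).valueAtUniformizer v}) (2 * z - 1))) * A' z)
    (hPreal :
      ∀ (U₀ : Subgroup ↥(finAdelic (↥(maximalRealSubfield L)) L (IsCMField.complexConj L) 3 ((StdForm.antidiagonal 3).over L))) (_ : IsTauLevel L U₀)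
      (φ : (quasiSplit (↥(maximalRealSubfield L)) L (IsCMField.complexConj L) 3).Adelic → ℂ) (_ : φ ∈ chiSectionSpacePair (ξ.bcη⁻¹ * ξ.bcψ⁻¹ * μω) ξ.ψ (tauLevel L U₀) ((1 : ↥(tauLevel L U₀) →* ℂ) : ↥(tauLevel L U₀) → ℂ)) (_ : Continuous φ)
      (_ : IsArchFinite L φ)
      (ν : Measure ↥(adelicUnipotent (↥(maximalRealSubfield L)) L (IsCMField.complexConj L) 3)) (_ : ν.IsHaarMeasure) (𝓕 : Set ↥(adelicUnipotent (↥(maximalRealSubfield L)) L (IsCMField.complexConj L) 3)) (_ : IsFundamentalDomain ↥(rationalUnipotent (↥(maximalRealSubfield L)) L (IsCMField.complexConj L) 3) 𝓕 ν) (_ : IsCompact (closure 𝓕)) (_ : ν.IsInvInvariant) (_ : ν 𝓕 = 1),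
      ∀ (ι : Type) [Fintype ι] (φ' : ι → (quasiSplit (↥(maximalRealSubfield L)) L (IsCMField.complexConj L) 3).Adelic → ℂ) (qv qcv : ι → ℂ → ℂ) (Pv : Set ℂ),
        LinearIndependent ℂ φ' →
        (∀ j, IsChiSectionPair (reflectChar (IsCMField.complexConj L) (ξ.bcη⁻¹ * ξ.bcψ⁻¹ * μω)) ξ.ψ (φ' j)) →
        (∀ j, Continuous (φ' j)) →
        (∀ j, ∃ C : ℝ, ∀ x, ‖φ' j x‖ ≤ C) →
        (∀ z : ℂ, 2 < z.re → (∑ j, qv j z • φ' j) = ((((ν 𝓕).toReal⁻¹ : ℝ)) : ℂ) • (fun g : (quasiSplit (↥(maximalRealSubfield L)) L (IsCMField.complexConj L) 3).Adelic => (∫ v : ↥(adelicUnipotent (↥(maximalRealSubfield L)) L (IsCMField.complexConj L) 3), flatSectionU φ z ((quasiSplit (↥(maximalRealSubfield L)) L (IsCMField.complexConj L) 3).toAdelic (weylLongU ((IsCMField.complexConj L : L ≃ₐ[↥(maximalRealSubfield L)] L) : L →+* L) (rfl : (StdForm.antidiagonal 3).over L = (StdForm.antidiagonal 3).over L)) *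 ((v : (quasiSplit (↥(maximalRealSubfield L)) L (IsCMField.complexConj L) 3).Adelic) * g)) ∂ν) * (((borelHeight g : ℝ) : ℂ) ^ (z - 2)))) →
        (∀ z₀ : ℂ, ∀ᶠ s in 𝓝[≠] z₀, s ∉ Pv) →
        (∀ z ∈ Pv, z.re ≤ 2) →
        (∀ j (z : ℂ), z ∉ Pv → AnalyticAt ℂ (qcv j) z) →
        (∀ j (z : ℂ), 2 < z.re → qcv j z = qv j z) →
        (∀ j, MeromorphicNFOn (qcv j) univ) →
      ∀ j (z : ℂ), 1 < z.re → z.im ≠ 0 → AnalyticAt ℂ (qcv j) z)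
    -- PER τ-GENERATOR — (R)′τ V3's axis-reality letter VERBATIM (:145–:161; ★ `hreal_row_of_ports` pays it when the columns are independent)
    (hreal :
      ∀ (U₀ : Subgroup ↥(finAdelic (↥(maximalRealSubfield L)) L (IsCMField.complexConj L) 3 ((StdForm.antidiagonal 3).over L))) (_ : IsTauLevel L U₀)
      (φ : (quasiSplit (↥(maximalRealSubfield L)) L (IsCMField.complexConj L) 3).Adelic → ℂ) (_ : φ ∈ chiSectionSpacePair (ξ.bcη⁻¹ * ξ.bcψ⁻¹ * μω) ξ.ψ (tauLevel L U₀) ((1 : ↥(tauLevel L U₀) →* ℂ) : ↥(tauLevel L U₀) → ℂ)) (_ : Continuous φ)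
      (_ : IsArchFinite L φ)
      (ν : Measure ↥(adelicUnipotent (↥(maximalRealSubfield L)) L (IsCMField.complexConj L) 3)) (_ : ν.IsHaarMeasure) (𝓕 : Set ↥(adelicUnipotent (↥(maximalRealSubfield L)) L (IsCMField.complexConj L) 3)) (_ : IsFundamentalDomain ↥(rationalUnipotent (↥(maximalRealSubfield L)) L (IsCMField.complexConj L) 3) 𝓕 ν) (_ : IsCompact (closure 𝓕)) (_ : ν.IsInvInvariant) (_ : ν 𝓕 = 1),
      ∀ (ι : Type) [Fintype ι] (φ' : ι → (quasiSplit (↥(maximalRealSubfield L)) L (IsCMField.complexConj L) 3).Adelic → ℂ) (qv qcv : ι → ℂ → ℂ) (Pv : Set ℂ),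
        (∀ j, IsChiSectionPair (reflectChar (IsCMField.complexConj L) (ξ.bcη⁻¹ * ξ.bcψ⁻¹ * μω)) ξ.ψ (φ' j)) →
        (∀ j, Continuous (φ' j)) →
        (∀ j, ∃ C : ℝ, ∀ x, ‖φ' j x‖ ≤ C) →
        (∀ z : ℂ, 2 < z.re → (∑ j, qv j z • φ' j) = ((((ν 𝓕).toReal⁻¹ : ℝ)) : ℂ) • (fun g : (quasiSplit (↥(maximalRealSubfield L)) L (IsCMField.complexConj L) 3).Adelic => (∫ v : ↥(adelicUnipotent (↥(maximalRealSubfield L)) L (IsCMField.complexConj L) 3), flatSectionU φ z ((quasiSplit (↥(maximalRealSubfield L)) L (IsCMField.complexConj L) 3).toAdelic (weylLongU ((IsCMField.complexConj L : L ≃ₐ[↥(maximalRealSubfield L)] L) : L →+* L) (rfl : (StdForm.antidiagonal 3).over L = (StdForm.antidiagonal 3).over L)) * ((v : (quasiSplit (↥(maximalRealSubfield L)) L (IsCMField.complexConj L) 3).Adelic) * g)) ∂ν) * (((borelHeight g : ℝ) : ℂ) ^ (z - 2)))) →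
        (∀ z₀ : ℂ, ∀ᶠ s in 𝓝[≠] z₀, s ∉ Pv) →
        (∀ z ∈ Pv, z.re ≤ 2) →
        (∀ j (z : ℂ), z ∉ Pv → AnalyticAt ℂ (qcv j) z) →
        (∀ j (z : ℂ), 2 < z.re → qcv j z = qv j z) →
        (∀ j, MeromorphicNFOn (qcv j) univ) →
      (∀ (μK : Measure ↥((standardMaximalCompactGL 3 L).comap (adelicVal (↥(maximalRealSubfield L)) L (IsCMField.complexConj L) 3 ((StdForm.antidiagonal 3).over L)) : Subgroup (quasiSplit (↥(maximalRealSubfield L)) L (IsCMField.complexConj L) 3).Adelic)) (_ : μK.IsHaarMeasure) (νI : Measure (AdeleRing (𝓞 L) L)ˣ) (_ : νI.IsHaarMeasure) (𝓕I : Set (AdeleRing (𝓞 L) L)ˣ) (_ : IsIdeleClassDomain L 𝓕I) (wc : ℂ → ℂ),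
          (∀ z : ℂ, wc z = (∑ j, qcv j z * ∫ k, φ' j (k : (quasiSplit (↥(maximalRealSubfield L)) L (IsCMField.complexConj L) 3).Adelic) * conj (φ (k : (quasiSplit (↥(maximalRealSubfield L)) L (IsCMField.complexConj L) 3).Adelic)) ∂μK) * ∫ x in {x : (AdeleRing (𝓞 L) L)ˣ | (IdeleClassGroup.ideleNorm L x : ℝ) ≤ 1} ∩ 𝓕I, ((IdeleClassGroup.ideleNorm L x : ℝ) : ℂ) * (((reflectChar (IsCMField.complexConj L) (ξ.bcη⁻¹ * ξ.bcψ⁻¹ * μω) x : ℂˣ) : ℂ) * conj (((ξ.bcη⁻¹ * ξ.bcψ⁻¹ * μω) x : ℂˣ) : ℂ)) ∂νI) → ∀ᶠ x : ℝ in 𝓝[≠] (3 / 2 : ℝ), (wc (x : ℂ)).im = 0)) :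
    ∀ (Ec : ℂ → (quasiSplit (↥(maximalRealSubfield L)) L (IsCMField.complexConj L) 3).Adelic → ℂ) (P : Set ℂ) (Fam : ℂ → (quasiSplit (↥(maximalRealSubfield L)) L (IsCMField.complexConj L) 3).L2 μ), (∀ z : ℂ, 2 < z.re → Ec z = eisensteinSeriesU (flatSectionU φ z)) →
      (∀ z₀ : ℂ, ∀ᶠ s in 𝓝[≠] z₀, s ∉ P) → (∀ g (z : ℂ), z ∉ P → AnalyticAt ℂ (fun z => Ec z g) z) →
      DifferentiableOn ℂ Fam Pᶜ → (∀ z : ℂ, z ∉ P → ((Fam z : (quasiSplit (↥(maximalRealSubfield L)) L (IsCMField.complexConj L) 3).L2 μ) : (quasiSplit (↥(maximalRealSubfield L)) L (IsCMField.complexConj L) 3).automorphicQuotient → ℂ) =ᵐ[μ] (quasiSplit (↥(maximalRealSubfield L)) L (IsCMField.complexConj L) 3).quotFun (truncation ν 𝓕 1 (Ec z))) →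
      ∃ C : ℝ, ∀ᶠ z in 𝓝[≠] ((3 : ℂ) / 2), ‖(z - ((3 : ℂ) / 2)) • Fam z‖ ≤ C := by
  intro Ec P Fam hEcE hPcd hEan hFd hFam
  have hPc : IsClosed P := isClosed_of_codiscrete hPcd
  -- the factorised scattering columns of the witness at the package (★ FILE A of (R)′τ)
  obtain ⟨ι, hι, φ', qv, qcv, Pv, a, hb, hφ'c, hφ'bd, hqφ, hPvcd, hPvre, hqcvP, hqcvq, hNF, ha, hqva, -⟩ :=
    columnsFactorisedRow_of_ports L μ νG hβ hμZ μa μf ξ μω hμu hunfK hPreal U₀ hU₀ φ hφ hφc hφa ν inferInstance 𝓕 h𝓕N h𝓕c inferInstance h𝓕1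
  -- ★ F5's scalar residue at `3∕2` and the removable singularity `d₀ = (z − 3∕2)·qc`
  obtain ⟨ρ, hρ, -⟩ := exists_residue_at_threeHalves_cm_three L (isUnitary_bcηInv_mul L ξ hμu) (bcηInv_mul_posRealIdele L ξ μω hμω) hS hurφ
    (heckeChar_one_isUnitary ↥(maximalRealSubfield L)) (heckeChar_one_posRealIdele ↥(maximalRealSubfield L)) hT' hurη q qc hqcq hPqcd hqa A hA hsrc
  obtain ⟨d₀, hd₀, hd₀q, -⟩ := exists_analyticAt_eventuallyEq_mul_sub_of_tendsto (eventually_nhdsWithin_iff.1 (hPqcd ((3 : ℂ) / 2)))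
    (fun x hx => (hqa x (hx.1 hx.2)).differentiableAt.differentiableWithinAt) hρ
  -- the Euler junction at `3∕2`: `qcv_j = qc·(a_j∕A)` near `3∕2`, so `dq_j := d₀·(a_j∕A)` is the per-coordinate simple-pole letter
  have hO : IsOpen {z : ℂ | 1 < z.re} := isOpen_lt continuous_const Complex.continuous_re
  have hmem : ((3 : ℂ) / 2) ∈ {z : ℂ | 1 < z.re} := by
    show (1 : ℝ) < (((3 : ℂ) / 2)).re
    norm_num
  have hr : ∀ j, AnalyticAt ℂ (fun z => a j z / A z) (3 / 2 : ℂ) := fun j =>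
    ((ha j).analyticAt (hO.mem_nhds hmem)).div (hA.analyticAt (hO.mem_nhds hmem)) hA32
  have hfacv : ∀ j, ∀ᶠ z in 𝓝[≠] ((3 / 2 : ℂ)), qcv j z = qc z * (a j z / A z) := fun j =>
    eventuallyEq_coord_of_junction hPqcd hqa hqcq hA hA32 hsrc hPvcd (hqcvP j) (hqcvq j) (hqva j) (ha j)
  have hdq : ∀ j, AnalyticAt ℂ (fun z => d₀ z * (a j z / A z)) ((3 : ℂ) / 2) := fun j => hd₀.mul (hr j)
  have hdqeq : ∀ j, ∀ᶠ z in 𝓝[≠] ((3 : ℂ) / 2), (fun z => d₀ z * (a j z / A z)) z = (z - ((3 : ℂ) / 2)) * qcv j z := fun j => by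
    filter_upwards [hd₀q, hfacv j] with z hz hz'
    show d₀ z * (a j z / A z) = (z - ((3 : ℂ) / 2)) * qcv j z
    rw [hz, hz']
    ring
  -- the joint candidate set `P ∪ Pv` (closed, co-discrete); the coordinates are holomorphic off it
  have hP''c : IsClosed (P ∪ Pv) := hPc.union (isClosed_of_codiscrete hPvcd)
  have hP''cd : ∀ z₀ : ℂ, ∀ᶠ s in 𝓝[≠] z₀, s ∉ P ∪ Pv := fun z₀ => ((hPcd z₀).and (hPvcd z₀)).mono fun s hs h => h.elim hs.1 hs.2
  have hqcP : ∀ j, DifferentiableOn ℂ (qcv j) (P ∪ Pv)ᶜ := fun j z hz => (hqcvP j z fun h => hz (Or.inr h)).differentiableAt.differentiableWithinAt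
  obtain ⟨Cφ, hφC⟩ := exists_bound_of_mem_chiSectionSpacePair_midBlock L ξ hμu hφ hφc
  -- (L2): the continued scalars from the coordinates (★ `exists_scalars_of_coords_global`)
  obtain ⟨wc, Bc, hwc, hwagree, hBc1, hBc2, hBagree, hwcf, hBcf⟩ := exists_scalars_of_coords_global L μK νI 𝓕I ν h𝓕1 (ξ.bcη⁻¹ * ξ.bcψ⁻¹ * μω) φ φ' hqφ hqcP hqcvq hP''c
    (fun j => by
      obtain ⟨C, hC⟩ := hφ'bd j
      exact integrable_restrict_mul_conj_of_bounded L μK (hφ'c j) hφc hC hφC)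
    (fun j l => by
      obtain ⟨C, hC⟩ := hφ'bd j
      obtain ⟨C', hC'⟩ := hφ'bd l
      exact integrable_restrict_mul_conj_of_bounded L μK (hφ'c j) (hφ'c l) hC hC')
  -- (L3): the pole data at `3∕2` from the per-coordinate letter, and the axis reality from the `hreal` letter
  obtain ⟨d, hd, hdw⟩ := exists_simplePole_of_coords_formula hdq hdqeq _ _ hwcf
  have hβB := exists_sqPole_kernelDiag_of_coords hdq hdqeq _ _ hBcf
  have hreal' := hreal U₀ hU₀ φ hφ hφc hφa ν inferInstance 𝓕 h𝓕N h𝓕c inferInstance h𝓕1 ι φ' qv qcv Pv hb hφ'c hφ'bd hqφ hPvcd hPvre hqcvP hqcvq hNF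
    μK inferInstance νI inferInstance 𝓕I h𝓕I wc hwcf
  -- ★ p865152's exports-level packager at the middle pole
  obtain ⟨C, hC⟩ := hMS32_of_exports_free L μ νG μK νI h𝓕I ν h𝓕N h𝓕1 h𝓕c hβ le_rfl
    (isUnitary_blockChar L ξ μω hμu (norm_eta_apply_eq_one L ξ) (norm_psi_apply_eq_one L ξ)) (midBlockChar_posRealIdele L ξ μω hμω) (norm_psi_apply_eq_one L ξ) ξ.hψ
    hφc (isChiSectionPair_of_mem hφ) hφC Ec hEcE hP''c hP''cd Fam (hFd.mono (compl_subset_compl.2 subset_union_left)) (fun z hz => hFam z fun h => hz (Or.inl h))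
    hwc hwagree hBc1 hBc2 hBagree hd hdw hreal' hβB
  exact ⟨C, hC⟩

/-! ## §2 HEAD — (V-τ) ED. 2 -/

/-- **HEAD — `resGMidBlock_ne_bot_of_tauGenerator_letters_v2` ((V-τ), ED. 2): `LHalfNeZero (ξ.bcη⁻¹·μω) → resGMidBlock L μ ξ μω ≠ ⊥` from a τ-admissible witness** — ★ ED. 1
`resGMidBlock_ne_bot_of_tauGenerator_letters` with its Maass–Selberg letter `hMS := hMS_tauWitness_of_columnLetters` (§1); visible: ED. 1's `hPL`, `hCT` + (ii)-rest, (iii), and — in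
place of `hMS` — the Maass–Selberg frame extras and (R)′τ V3's letters `hunfK hPreal hreal`. [cite: Rogawski1990, §13.9 (ii) p. 229] [cite: MoeglinWaldspurger1995, IV.1.11, IV.2.3, V.3.13]
[cite: BernsteinLapid2019, Thm 2.3, §4] -/
theorem resGMidBlock_ne_bot_of_tauGenerator_letters_v2
    (μ : Measure (quasiSplit (↥(maximalRealSubfield L)) L (IsCMField.complexConj L) 3).automorphicQuotient) [(quasiSplit (↥(maximalRealSubfield L)) L (IsCMField.complexConj L) 3).IsAutomorphicMeasure μ]
    (μω : HeckeCharacter L) (hμu : μω.IsUnitary)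
    (hμω : ∀ x : ideleGroup ↥(maximalRealSubfield L), μω (AdeleRing.ideleBaseChange (↥(maximalRealSubfield L)) L x) = quadraticHeckeCharCM L x)
    (ξ : OneDimAutRepH L)
    -- the exports' frame (F)(F′) of ★ p865131 (Haar measure on `G(𝔸)`, covering weight, quotient measure, the ports' auxiliary Haar measures)
    (νG : Measure (quasiSplit (↥(maximalRealSubfield L)) L (IsCMField.complexConj L) 3).Adelic) [νG.IsHaarMeasure] [νG.IsInvInvariant] [SFinite νG]
    {β : (quasiSplit (↥(maximalRealSubfield L)) L (IsCMField.complexConj L) 3).Adelic → ℝ≥0∞}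
    (hβ : IsCoveringWeight ↥((arithmeticBorel (↥(maximalRealSubfield L)) L (IsCMField.complexConj L) 3).map (quasiSplit (↥(maximalRealSubfield L)) L (IsCMField.complexConj L) 3).arithmeticSubgroup.subtype) β)
    {μZ : Measure (borelQuotient (↥(maximalRealSubfield L)) L (IsCMField.complexConj L) 3)} [SFinite μZ]
    (hμZ : ∀ f : borelQuotient (↥(maximalRealSubfield L)) L (IsCMField.complexConj L) 3 → ℝ≥0∞, Measurable f → ∫⁻ z, f z ∂μZ = ∫⁻ g, β g * f (toBorelQuotient (↥(maximalRealSubfield L)) L (IsCMField.complexConj L) 3 g) ∂νG)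
    (μa : Measure (arch (↥(maximalRealSubfield L)) L (IsCMField.complexConj L) 3 ((StdForm.antidiagonal 3).over L))) [μa.IsHaarMeasure] [μa.IsMulRightInvariant]
    (μf : Measure (finAdelic (↥(maximalRealSubfield L)) L (IsCMField.complexConj L) 3 ((StdForm.antidiagonal 3).over L))) [μf.IsHaarMeasure]
    -- (i) THE τ-ADMISSIBLE WITNESS AS DATA: a τ-level `U₀`, a continuous `K_∞`-finite pair-section of level `(ι_f U₀, 1)` (e.g. the shifted pure tensor `Φ^{p,q}_∞ ⊗ Φ_f`)
    (U₀ : Subgroup ↥(finAdelic (↥(maximalRealSubfield L)) L (IsCMField.complexConj L) 3 ((StdForm.antidiagonal 3).over L))) (hU₀ : IsTauLevel L U₀)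
    (φ : (quasiSplit (↥(maximalRealSubfield L)) L (IsCMField.complexConj L) 3).Adelic → ℂ) (hφ : φ ∈ chiSectionSpacePair (ξ.bcη⁻¹ * ξ.bcψ⁻¹ * μω) ξ.ψ (tauLevel L U₀) ((1 : ↥(tauLevel L U₀) →* ℂ) : ↥(tauLevel L U₀) → ℂ)) (hφc : Continuous φ) (hφa : IsArchFinite L φ)
    -- the NORMALISED Heisenberg package of ★ p865131's row (Haar, inversion-invariant, `ν 𝓕 = 1`)
    (ν : Measure ↥(adelicUnipotent (↥(maximalRealSubfield L)) L (IsCMField.complexConj L) 3)) [ν.IsHaarMeasure] [ν.IsInvInvariant]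
    {𝓕 : Set ↥(adelicUnipotent (↥(maximalRealSubfield L)) L (IsCMField.complexConj L) 3)}
    (h𝓕N : IsFundamentalDomain ↥(rationalUnipotent (↥(maximalRealSubfield L)) L (IsCMField.complexConj L) 3) 𝓕 ν) (h𝓕c : IsCompact (closure 𝓕)) (h𝓕1 : ν 𝓕 = 1)
    -- (i) LETTER — THE POLE LEDGER over the exported continuation (estate T's `hPL` clause shape; payers: τ-MS32 ★ p865152, the off-axis machinery of (R)′τ V3)
    (hPL : ∀ (Ec : ℂ → (quasiSplit (↥(maximalRealSubfield L)) L (IsCMField.complexConj L) 3).Adelic → ℂ) (P : Set ℂ), (∀ z : ℂ, 2 < z.re → Ec z = eisensteinSeriesU (flatSectionU φ z)) →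
      (∀ z₀ : ℂ, ∀ᶠ s in 𝓝[≠] z₀, s ∉ P) → (∀ g (z : ℂ), z ∉ P → AnalyticAt ℂ (fun z => Ec z g) z) →
      (∀ z₀ ∈ P, 1 < z₀.re → z₀ ≠ ((3 : ℂ) / 2) → ∀ K : Set (quasiSplit (↥(maximalRealSubfield L)) L (IsCMField.complexConj L) 3).Adelic, IsCompact K → ∃ C : ℝ, ∀ᶠ z in 𝓝[≠] z₀, ∀ g ∈ K, ‖Ec z g‖ ≤ C) ∧
      (∀ g, ∃ C : ℝ, ∀ᶠ z in 𝓝[≠] ((3 : ℂ) / 2), ‖(z - ((3 : ℂ) / 2)) * Ec z g‖ ≤ C))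
    -- (ii) ★ p863385's row (ii): the domain `D` and the scalar road's letters; the constant-term identity as a LETTER over the exported continuation OFF its candidate set (payers as in the rows head)
    {D : Set ℂ} (hDo : IsOpen D) (hD : ∀ᶠ z in 𝓝[≠] ((3 : ℂ) / 2), z ∈ D) (hDsub : D ⊆ ({z : ℂ | 1 < z.re} \ (↑({(3 : ℂ) / 2} : Finset ℂ) : Set ℂ)))
    (ψ φt : ℂ → (quasiSplit (↥(maximalRealSubfield L)) L (IsCMField.complexConj L) 3).Adelic → ℂ)
    (hCT : ∀ (Ec : ℂ → (quasiSplit (↥(maximalRealSubfield L)) L (IsCMField.complexConj L) 3).Adelic → ℂ) (P : Set ℂ), (∀ z : ℂ, 2 < z.re → Ec z = eisensteinSeriesU (flatSectionU φ z)) →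
      (∀ z₀ : ℂ, ∀ᶠ s in 𝓝[≠] z₀, s ∉ P) → (∀ g (z : ℂ), z ∉ P → AnalyticAt ℂ (fun z => Ec z g) z) →
      ∀ z ∈ D, z ∉ P → ∀ g : (quasiSplit (↥(maximalRealSubfield L)) L (IsCMField.complexConj L) 3).Adelic, borelConstantTerm ν 𝓕 (Ec z) g = φ g * (((borelHeight g : ℝ≥0) : ℝ) : ℂ) ^ z + ψ z g * (((borelHeight g : ℝ≥0) : ℝ) : ℂ) ^ (2 - z))
    (q qc : ℂ → ℂ) {Pq : Set ℂ} (hqcq : ∀ z : ℂ, 2 < z.re → qc z = q z) (hPqcd : ∀ z₀ : ℂ, ∀ᶠ s in 𝓝[≠] z₀, s ∉ Pq) (hqa : ∀ z : ℂ, z ∉ Pq → AnalyticAt ℂ qc z)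
    (hfac : ∀ᶠ z in 𝓝[≠] ((3 : ℂ) / 2), ∀ g, ψ z g = qc z * φt z g) (hφt : ∀ g, ContinuousAt (fun z => φt z g) ((3 : ℂ) / 2))
    {g₀ : (quasiSplit (↥(maximalRealSubfield L)) L (IsCMField.complexConj L) 3).Adelic} (hg₀ : φt ((3 : ℂ) / 2) g₀ ≠ 0) {Cφt : ℝ} (hφtbd : ∀ g, ‖φt ((3 : ℂ) / 2) g‖ ≤ Cφt)
    -- (iii) ★ p863385's row (iii) VERBATIM (payers: ★ p864821 + ★ `hA32_shifted_of_record_at_basePoint_of_modEq` for the shifted pure tensor)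
    {S : Set (HeightOneSpectrum (𝓞 L))} {T' : Set (HeightOneSpectrum (𝓞 ↥(maximalRealSubfield L)))}
    (hS : S.Finite) (hurφ : ∀ w ∉ S, (ξ.bcη⁻¹ * μω).IsUnramifiedAt w) (hT' : T'.Finite) (hurη : ∀ v ∉ T', (1 : HeckeCharacter ↥(maximalRealSubfield L)).IsUnramifiedAt v)
    (A : ℂ → ℂ) (hA : DifferentiableOn ℂ A {z : ℂ | 1 < z.re})
    (hsrc : ∀ z : ℂ, 2 < z.re → q z = A z *
          ((partialStandardL S (fun w => {(ξ.bcη⁻¹ * μω).valueAtUniformizer w}) (z - 1) * partialStandardL T' (fun v => {(1 : HeckeCharacter ↥(maximalRealSubfield L)).valueAtUniformizer v}) (2 * z - 2)) /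
            (partialStandardL S (fun w => {(ξ.bcη⁻¹ * μω).valueAtUniformizer w}) z * partialStandardL T' (fun v => {(1 : HeckeCharacter ↥(maximalRealSubfield L)).valueAtUniformizer v}) (2 * z - 1))))
    (hA32 : A (3 / 2) ≠ 0)
    -- the Maass–Selberg frame extras of ★ p865152 (Haar measure on `K_max`, Haar measure on the ideles, an idele-class domain)
    (μK : Measure ↥((standardMaximalCompactGL 3 L).comap (adelicVal (↥(maximalRealSubfield L)) L (IsCMField.complexConj L) 3 ((StdForm.antidiagonal 3).over L)) : Subgroup (quasiSplit (↥(maximalRealSubfield L)) L (IsCMField.complexConj L) 3).Adelic)) [μK.IsHaarMeasure]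
    (νI : Measure (AdeleRing (𝓞 L) L)ˣ) [νI.IsHaarMeasure] {𝓕I : Set (AdeleRing (𝓞 L) L)ˣ} (h𝓕I : IsIdeleClassDomain L 𝓕I)
    -- PER τ-ADMISSIBLE SECTION — (R)′τ V3's letters VERBATIM (★ p865313 :117–:143): the Euler factorisation on `K_max` at the scalar of record (`hunfK^τ`, ★ p865072 for pure tensors) and the off-axis pole exclusion
    (hunfK :
      ∀ (U₀ : Subgroup ↥(finAdelic (↥(maximalRealSubfield L)) L (IsCMField.complexConj L) 3 ((StdForm.antidiagonal 3).over L))) (_ : IsTauLevel L U₀)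
      (φ : (quasiSplit (↥(maximalRealSubfield L)) L (IsCMField.complexConj L) 3).Adelic → ℂ) (_ : φ ∈ chiSectionSpacePair (ξ.bcη⁻¹ * ξ.bcψ⁻¹ * μω) ξ.ψ (tauLevel L U₀) ((1 : ↥(tauLevel L U₀) →* ℂ) : ↥(tauLevel L U₀) → ℂ)) (_ : Continuous φ)
      (_ : IsArchFinite L φ)
      (ν : Measure ↥(adelicUnipotent (↥(maximalRealSubfield L)) L (IsCMField.complexConj L) 3)) (_ : ν.IsHaarMeasure) (𝓕 : Set ↥(adelicUnipotent (↥(maximalRealSubfield L)) L (IsCMField.complexConj L) 3)) (_ : IsFundamentalDomain ↥(rationalUnipotent (↥(maximalRealSubfield L)) L (IsCMField.complexConj L) 3) 𝓕 ν) (_ : IsCompact (closure 𝓕)) (_ : ν.IsInvInvariant) (_ : ν 𝓕 = 1),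
      ∀ k : (quasiSplit (↥(maximalRealSubfield L)) L (IsCMField.complexConj L) 3).Adelic, adelicVal (↥(maximalRealSubfield L)) L (IsCMField.complexConj L) 3 ((StdForm.antidiagonal 3).over L) k ∈ standardMaximalCompactGL 3 L →
        ∃ A' : ℂ → ℂ, DifferentiableOn ℂ A' {z : ℂ | 1 < z.re} ∧ ∀ z : ℂ, 2 < z.re →
          (∫ v : ↥(adelicUnipotent (↥(maximalRealSubfield L)) L (IsCMField.complexConj L) 3), flatSectionU φ z ((quasiSplit (↥(maximalRealSubfield L)) L (IsCMField.complexConj L) 3).toAdelic (weylLongU ((IsCMField.complexConj L : L ≃ₐ[↥(maximalRealSubfield L)] L) : L →+* L) (rfl : (StdForm.antidiagonal 3).over L = (StdForm.antidiagonal 3).over L)) * ((v : (quasiSplit (↥(maximalRealSubfield L)) L (IsCMField.complexConj L) 3).Adelic) * k)) ∂ν) =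
            ((partialStandardL S (fun w => {(ξ.bcη⁻¹ * μω).valueAtUniformizer w}) (z - 1) * partialStandardL T' (fun v => {(1 : HeckeCharacter ↥(maximalRealSubfield L)).valueAtUniformizer v}) (2 * z - 2)) / (partialStandardL S (fun w => {(ξ.bcη⁻¹ * μω).valueAtUniformizer w}) z * partialStandardL T' (fun v => {(1 : HeckeCharacter ↥(maximalRealSubfield L)).valueAtUniformizer v}) (2 * z - 1))) * A' z)
    (hPreal :
      ∀ (U₀ : Subgroup ↥(finAdelic (↥(maximalRealSubfield L)) L (IsCMField.complexConj L) 3 ((StdForm.antidiagonal 3).over L))) (_ : IsTauLevel L U₀)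
      (φ : (quasiSplit (↥(maximalRealSubfield L)) L (IsCMField.complexConj L) 3).Adelic → ℂ) (_ : φ ∈ chiSectionSpacePair (ξ.bcη⁻¹ * ξ.bcψ⁻¹ * μω) ξ.ψ (tauLevel L U₀) ((1 : ↥(tauLevel L U₀) →* ℂ) : ↥(tauLevel L U₀) → ℂ)) (_ : Continuous φ)
      (_ : IsArchFinite L φ)
      (ν : Measure ↥(adelicUnipotent (↥(maximalRealSubfield L)) L (IsCMField.complexConj L) 3)) (_ : ν.IsHaarMeasure) (𝓕 : Set ↥(adelicUnipotent (↥(maximalRealSubfield L)) L (IsCMField.complexConj L) 3)) (_ : IsFundamentalDomain ↥(rationalUnipotent (↥(maximalRealSubfield L)) L (IsCMField.complexConj L) 3) 𝓕 ν) (_ : IsCompact (closure 𝓕)) (_ : ν.IsInvInvariant) (_ : ν 𝓕 = 1),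
      ∀ (ι : Type) [Fintype ι] (φ' : ι → (quasiSplit (↥(maximalRealSubfield L)) L (IsCMField.complexConj L) 3).Adelic → ℂ) (qv qcv : ι → ℂ → ℂ) (Pv : Set ℂ),
        LinearIndependent ℂ φ' →
        (∀ j, IsChiSectionPair (reflectChar (IsCMField.complexConj L) (ξ.bcη⁻¹ * ξ.bcψ⁻¹ * μω)) ξ.ψ (φ' j)) →
        (∀ j, Continuous (φ' j)) →
        (∀ j, ∃ C : ℝ, ∀ x, ‖φ' j x‖ ≤ C) →
        (∀ z : ℂ, 2 < z.re → (∑ j, qv j z • φ' j) = ((((ν 𝓕).toReal⁻¹ : ℝ)) : ℂ) • (fun g : (quasiSplit (↥(maximalRealSubfield L)) L (IsCMField.complexConj L) 3).Adelic => (∫ v : ↥(adelicUnipotent (↥(maximalRealSubfield L)) L (IsCMField.complexConj L) 3), flatSectionU φ z ((quasiSplit (↥(maximalRealSubfield L)) L (IsCMField.complexConj L) 3).toAdelic (weylLongU ((IsCMField.complexConj L : L ≃ₐ[↥(maximalRealSubfield L)] L) : L →+* L) (rfl : (StdForm.antidiagonal 3).over L = (StdForm.antidiagonal 3).over L)) *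 ((v : (quasiSplit (↥(maximalRealSubfield L)) L (IsCMField.complexConj L) 3).Adelic) * g)) ∂ν) * (((borelHeight g : ℝ) : ℂ) ^ (z - 2)))) →
        (∀ z₀ : ℂ, ∀ᶠ s in 𝓝[≠] z₀, s ∉ Pv) →
        (∀ z ∈ Pv, z.re ≤ 2) →
        (∀ j (z : ℂ), z ∉ Pv → AnalyticAt ℂ (qcv j) z) →
        (∀ j (z : ℂ), 2 < z.re → qcv j z = qv j z) →
        (∀ j, MeromorphicNFOn (qcv j) univ) →
      ∀ j (z : ℂ), 1 < z.re → z.im ≠ 0 → AnalyticAt ℂ (qcv j) z)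
    -- PER τ-GENERATOR — (R)′τ V3's axis-reality letter VERBATIM (:145–:161; ★ `hreal_row_of_ports` pays it when the columns are independent)
    (hreal :
      ∀ (U₀ : Subgroup ↥(finAdelic (↥(maximalRealSubfield L)) L (IsCMField.complexConj L) 3 ((StdForm.antidiagonal 3).over L))) (_ : IsTauLevel L U₀)
      (φ : (quasiSplit (↥(maximalRealSubfield L)) L (IsCMField.complexConj L) 3).Adelic → ℂ) (_ : φ ∈ chiSectionSpacePair (ξ.bcη⁻¹ * ξ.bcψ⁻¹ * μω) ξ.ψ (tauLevel L U₀) ((1 : ↥(tauLevel L U₀) →* ℂ) : ↥(tauLevel L U₀) → ℂ)) (_ : Continuous φ)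
      (_ : IsArchFinite L φ)
      (ν : Measure ↥(adelicUnipotent (↥(maximalRealSubfield L)) L (IsCMField.complexConj L) 3)) (_ : ν.IsHaarMeasure) (𝓕 : Set ↥(adelicUnipotent (↥(maximalRealSubfield L)) L (IsCMField.complexConj L) 3)) (_ : IsFundamentalDomain ↥(rationalUnipotent (↥(maximalRealSubfield L)) L (IsCMField.complexConj L) 3) 𝓕 ν) (_ : IsCompact (closure 𝓕)) (_ : ν.IsInvInvariant) (_ : ν 𝓕 = 1),
      ∀ (ι : Type) [Fintype ι] (φ' : ι → (quasiSplit (↥(maximalRealSubfield L)) L (IsCMField.complexConj L) 3).Adelic → ℂ) (qv qcv : ι → ℂ → ℂ) (Pv : Set ℂ),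
        (∀ j, IsChiSectionPair (reflectChar (IsCMField.complexConj L) (ξ.bcη⁻¹ * ξ.bcψ⁻¹ * μω)) ξ.ψ (φ' j)) →
        (∀ j, Continuous (φ' j)) →
        (∀ j, ∃ C : ℝ, ∀ x, ‖φ' j x‖ ≤ C) →
        (∀ z : ℂ, 2 < z.re → (∑ j, qv j z • φ' j) = ((((ν 𝓕).toReal⁻¹ : ℝ)) : ℂ) • (fun g : (quasiSplit (↥(maximalRealSubfield L)) L (IsCMField.complexConj L) 3).Adelic => (∫ v : ↥(adelicUnipotent (↥(maximalRealSubfield L)) L (IsCMField.complexConj L) 3), flatSectionU φ z ((quasiSplit (↥(maximalRealSubfield L)) L (IsCMField.complexConj L) 3).toAdelic (weylLongU ((IsCMField.complexConj L : L ≃ₐ[↥(maximalRealSubfield L)] L) : L →+* L) (rfl : (StdForm.antidiagonal 3).over L = (StdForm.antidiagonal 3).over L)) * ((v : (quasiSplit (↥(maximalRealSubfield L)) L (IsCMField.complexConj L) 3).Adelic) * g)) ∂ν) * (((borelHeight g : ℝ) : ℂ) ^ (z - 2)))) →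
        (∀ z₀ : ℂ, ∀ᶠ s in 𝓝[≠] z₀, s ∉ Pv) →
        (∀ z ∈ Pv, z.re ≤ 2) →
        (∀ j (z : ℂ), z ∉ Pv → AnalyticAt ℂ (qcv j) z) →
        (∀ j (z : ℂ), 2 < z.re → qcv j z = qv j z) →
        (∀ j, MeromorphicNFOn (qcv j) univ) →
      (∀ (μK : Measure ↥((standardMaximalCompactGL 3 L).comap (adelicVal (↥(maximalRealSubfield L)) L (IsCMField.complexConj L) 3 ((StdForm.antidiagonal 3).over L)) : Subgroup (quasiSplit (↥(maximalRealSubfield L)) L (IsCMField.complexConj L) 3).Adelic)) (_ : μK.IsHaarMeasure) (νI : Measure (AdeleRing (𝓞 L) L)ˣ) (_ : νI.IsHaarMeasure) (𝓕I : Set (AdeleRing (𝓞 L) L)ˣ) (_ : IsIdeleClassDomain L 𝓕I) (wc : ℂ → ℂ),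
          (∀ z : ℂ, wc z = (∑ j, qcv j z * ∫ k, φ' j (k : (quasiSplit (↥(maximalRealSubfield L)) L (IsCMField.complexConj L) 3).Adelic) * conj (φ (k : (quasiSplit (↥(maximalRealSubfield L)) L (IsCMField.complexConj L) 3).Adelic)) ∂μK) * ∫ x in {x : (AdeleRing (𝓞 L) L)ˣ | (IdeleClassGroup.ideleNorm L x : ℝ) ≤ 1} ∩ 𝓕I, ((IdeleClassGroup.ideleNorm L x : ℝ) : ℂ) * (((reflectChar (IsCMField.complexConj L) (ξ.bcη⁻¹ * ξ.bcψ⁻¹ * μω) x : ℂˣ) : ℂ) * conj (((ξ.bcη⁻¹ * ξ.bcψ⁻¹ * μω) x : ℂˣ) : ℂ)) ∂νI) → ∀ᶠ x : ℝ in 𝓝[≠] (3 / 2 : ℝ), (wc (x : ℂ)).im = 0)) :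
    LHalfNeZero (ξ.bcη⁻¹ * μω) → resGMidBlock L μ ξ μω ≠ ⊥ :=
  resGMidBlock_ne_bot_of_tauGenerator_letters L μ μω hμu hμω ξ νG hβ hμZ μa μf U₀ hU₀ φ hφ hφc hφa ν h𝓕N h𝓕c h𝓕1 hPL hDo hD hDsub ψ φt hCT q qc hqcq hPqcd hqa
    hfac hφt hg₀ hφtbd hS hurφ hT' hurη A hA hsrc hA32
    (hMS_tauWitness_of_columnLetters L μ μω hμu hμω ξ νG hβ hμZ μa μf U₀ hU₀ φ hφ hφc hφa ν h𝓕N h𝓕c h𝓕1 q qc hqcq hPqcd hqa hS hurφ hT' hurη A hA hsrc hA32 μK νI h𝓕I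
      hunfK hPreal hreal)

end Summit.HodgeConjecture.HodgeConjecture.R90.S8

end
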